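import Literature.RepresentationTheory.KonnoKonno2007.RealUnitaryRankOneKAK
import HarnessLib

/-!
# Stabilisers of basis vectors in `U(α,β)`: the fixer subgroups, unit columns and unit rows, commutation
# across disjoint supports — group side, kernel

Topic `RepresentationTheory/KonnoKonno2007`; namespace `Literature.RepresentationTheory.KonnoKonno2007.RealDualPair`.
KERNEL ONLY: one definition with body (`fixer`, a subgroup), 0 records, 0 `Prop`-valued definitions, 0 hypotheses;
every statement is a kernel fact about the explicit matrix group `UForm α β = U(diag(1_α, −1_β))` of
`RealUnitaryDualPair` and the matrices `UForm.kV`, `hypV` of `RealUnitaryDualPair` / `RealUnitaryRankOneKAK`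
(tag `folklore`).  This is the linear-algebra layer of the `KAK` decomposition of `U(α,β)` at ARBITRARY real rank
(sequel files `RealUnitaryKAKStep`, `RealUnitaryKAK`); the rank-one file `RealUnitaryRankOneKAK` needed only the
stabiliser of ONE vector `e_{q₀}` (`exists_eq_kV_of_col_eq`), the induction over `min(|α|,|β|)` planes needs the
stabiliser of any set of basis vectors.

* §1 the ROW form identity `g J gᴴ = J` (`UForm.mul_signForm_mul_conjTranspose`, `UForm.form_apply_row`) next to the
  tree's column identity `gᴴ J g = J` (`UForm.form_apply`); `J² = 1` (`signForm_mul_signForm`);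
* §2 **`fixer s ≤ U(α,β)`**, the subgroup of elements whose matrix has the unit column `e_{i₀}` for every `i₀ ∈ s`
  (`mem_fixer_iff`), and the key rigidity **`UForm.row_eq_of_col_eq`**: a unit COLUMN `e_{i₀}` of an element of
  `U(α,β)` forces the unit ROW `e_{i₀}` (the form is non-degenerate on `e_{i₀}`); membership of `kV (u, w)`
  (`kV_mem_fixer`) and of the planar boost `hypV p₀ q₀ t` for planes avoiding `s` (`hypV_mem_fixer`,
  `hypV_col_eq_one`);
* §3 **one side fixed ⇒ compact**: an element fixing every `e_{inr b}` is `kV (u, 1)`, an element fixing every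
  `e_{inl a}` is `kV (1, w)` (`exists_eq_kV_inl_of_forall_inr`, `exists_eq_kV_inr_of_forall_inl`) — the terminal step
  of the `KAK` induction;
* §4 **commutation across disjoint supports**: two square matrices, one the identity on the coordinates in `S`, the
  other the identity off `S`, commute (`Matrix.mul_eq_mul_of_fix`); hence an element of `fixer {inl p₀, inr q₀}`
  commutes with the boost of the plane `(p₀, q₀)` (`mul_hypV_comm_of_mem_fixer`) and boosts in disjoint planes
  commute (`hypV_comm`);
* §5 **unitary matrices with prescribed orthonormal columns**: a unit vector of `ℂⁿ` vanishing on a finite set `F` of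
  coordinates is the `i₁`-th column (`i₁ ∉ F`) of a unitary matrix whose `F`-columns are the unit vectors
  (`exists_unitaryGroup_col_eq_of_orthogonal`; by `Orthonormal.exists_orthonormalBasis_extension_of_card_eq`) — the
  rotations of the induction, which must not move the vectors already straightened.

Provenance (statement shapes only; nothing is cited as a hypothesis): elementary linear algebra of isometry groups of
hermitian forms, as used in the proof of the Cartan decomposition `G = K A K` [Knapp2002, Thm. 7.39] for `U(p,q)`.

BOUNDARY.  Imports only `RealUnitaryRankOneKAK` (tree) and Mathlib through it; no record, no `Prop` definition, no
cited fact; nothing specific to the Hodge/Picard programme.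

References: [Knapp2002] A. W. Knapp, *Lie Groups Beyond an Introduction*, 2nd ed., Birkhäuser 2002, Thm. 7.39;
[KonnoKonno2007] K. Konno, T. Konno, Kyushu J. Math. 61 (2007), §3.1 (the groups `U(p,q)`, `K = U(p) × U(q)`).
-/

set_option autoImplicit false

noncomputable section

open Matrix Complex
open scoped ComplexConjugate

namespace Literature.RepresentationTheory.KonnoKonno2007

namespace RealDualPair

open Literature.NumberTheory.Automorphic Literature.NumberTheory.Automorphic.UnitaryGroup

variable {α β : Type*} [Fintype α] [DecidableEq α] [Fintype β] [DecidableEq β]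

/-! ## 1. The row form identity `g J gᴴ = J` -/

section Row

omit [Fintype α] [Fintype β] in
/-- `J² = 1` for `J = diag(1_α, −1_β)`. [cite: Knapp2002, I §1 Example 3] -/
theorem signForm_mul_signForm [Fintype α] [Fintype β] : signForm α β * signForm α β = 1 := by
  rw [signForm_eq_diagonal, Matrix.diagonal_mul_diagonal, ← Matrix.diagonal_one]
  congr 1
  funext i
  rcases i with a | b <;> simp

/-- **`g J gᴴ = J`** for `g ∈ U(α,β)` (the inverse `J gᴴ J` of `g` is two-sided). [cite: Knapp2002, I §1 Example 3] -/
theorem UForm.mul_signForm_mul_conjTranspose (g : UForm α β) :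
    (((g : UForm α β) : GL (α ⊕ β) ℂ) : Matrix (α ⊕ β) (α ⊕ β) ℂ) * signForm α β *
        (((g : UForm α β) : GL (α ⊕ β) ℂ) : Matrix (α ⊕ β) (α ⊕ β) ℂ)ᴴ = signForm α β := by
  set M := (((g : UForm α β) : GL (α ⊕ β) ℂ) : Matrix (α ⊕ β) (α ⊕ β) ℂ) with hM
  have h1 : Mᴴ * signForm α β * M = signForm α β := (mem_unitaryGroupOfForm_star_iff_conjTranspose _ _).1 g.2
  have h2 : signForm α β * Mᴴ * signForm α β * M = 1 := by
    calc signForm α β * Mᴴ * signForm α β * M = signForm α β * (Mᴴ * signForm α β * M) := by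
          simp only [Matrix.mul_assoc]
      _ = 1 := by rw [h1, signForm_mul_signForm]
  have h3 : M * (signForm α β * Mᴴ * signForm α β) = 1 := mul_eq_one_comm.1 h2
  calc M * signForm α β * Mᴴ = M * signForm α β * Mᴴ * (signForm α β * signForm α β) := by
        rw [signForm_mul_signForm, Matrix.mul_one]
    _ = M * (signForm α β * Mᴴ * signForm α β) * signForm α β := by simp only [Matrix.mul_assoc]
    _ = signForm α β := by rw [h3, Matrix.one_mul]

/-- entries of `M · diag(1_α, −1_β) · Mᴴ`: `Σ_a M_{i a} conj(M_{j a}) − Σ_b M_{i b} conj(M_{j b})`. [cite: Knapp2002, I §1 Example 3] -/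
theorem mul_signForm_mul_conjTranspose_apply (M : Matrix (α ⊕ β) (α ⊕ β) ℂ) (i j : α ⊕ β) :
    (M * signForm α β * Mᴴ) i j =
      (∑ a, M i (Sum.inl a) * star (M j (Sum.inl a))) - ∑ b, M i (Sum.inr b) * star (M j (Sum.inr b)) := by
  rw [signForm_eq_diagonal, Matrix.mul_apply, Fintype.sum_sum_type]
  simp only [Matrix.mul_diagonal, Matrix.conjTranspose_apply, Sum.elim_inl, Sum.elim_inr, mul_one,
    mul_neg, neg_mul, Finset.sum_neg_distrib, sub_eq_add_neg]

/-- **the row form identity by entries**: for `g ∈ U(α,β)` with matrix `M`,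
`Σ_a M_{i a} conj(M_{j a}) − Σ_b M_{i b} conj(M_{j b}) = diag(1_α, −1_β)_{i j}`. [cite: Knapp2002, I §1 Example 3] -/
theorem UForm.form_apply_row (g : UForm α β) (i j : α ⊕ β) :
    (∑ a, (((g : UForm α β) : GL (α ⊕ β) ℂ) : Matrix (α ⊕ β) (α ⊕ β) ℂ) i (Sum.inl a) *
        star ((((g : UForm α β) : GL (α ⊕ β) ℂ) : Matrix (α ⊕ β) (α ⊕ β) ℂ) j (Sum.inl a))) -
      ∑ b, (((g : UForm α β) : GL (α ⊕ β) ℂ) : Matrix (α ⊕ β) (α ⊕ β) ℂ) i (Sum.inr b) *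
        star ((((g : UForm α β) : GL (α ⊕ β) ℂ) : Matrix (α ⊕ β) (α ⊕ β) ℂ) j (Sum.inr b)) =
      signForm α β i j := by
  rw [← mul_signForm_mul_conjTranspose_apply, UForm.mul_signForm_mul_conjTranspose]

end Row

/-! ## 2. Fixers of basis vectors -/

section Fixer

variable (α β) in
/-- **the fixer of the basis vectors `e_{i₀}`, `i₀ ∈ s`**: the subgroup of `g ∈ U(α,β)` whose matrix has the unit
column `e_{i₀}` (`g e_{i₀} = e_{i₀}`) for every `i₀ ∈ s`. [cite: Knapp2002, Thm 7.39] -/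
def fixer (s : Set (α ⊕ β)) : Subgroup (UForm α β) where
  carrier := {g | ∀ i₀ ∈ s, ∀ i, (((g : UForm α β) : GL (α ⊕ β) ℂ) : Matrix (α ⊕ β) (α ⊕ β) ℂ) i i₀ =
    (1 : Matrix (α ⊕ β) (α ⊕ β) ℂ) i i₀}
  one_mem' := fun i₀ _ i => by rw [UForm.coe_one]
  mul_mem' {g h} hg hh := fun i₀ hi₀ i => by
    rw [UForm.coe_mul, Matrix.mul_apply]
    calc ∑ k, (((g : UForm α β) : GL (α ⊕ β) ℂ) : Matrix (α ⊕ β) (α ⊕ β) ℂ) i k *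
            (((h : UForm α β) : GL (α ⊕ β) ℂ) : Matrix (α ⊕ β) (α ⊕ β) ℂ) k i₀
        = ∑ k, (((g : UForm α β) : GL (α ⊕ β) ℂ) : Matrix (α ⊕ β) (α ⊕ β) ℂ) i k *
            (1 : Matrix (α ⊕ β) (α ⊕ β) ℂ) k i₀ := Finset.sum_congr rfl fun k _ => by rw [hh i₀ hi₀ k]
      _ = (1 : Matrix (α ⊕ β) (α ⊕ β) ℂ) i i₀ := by rw [← Matrix.mul_apply, Matrix.mul_one, hg i₀ hi₀ i]
  inv_mem' {g} hg := fun i₀ hi₀ i => by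
    have e : (((g⁻¹ : UForm α β) : GL (α ⊕ β) ℂ) : Matrix (α ⊕ β) (α ⊕ β) ℂ) i i₀ =
        ((((g⁻¹ : UForm α β) : GL (α ⊕ β) ℂ) : Matrix (α ⊕ β) (α ⊕ β) ℂ) *
          (((g : UForm α β) : GL (α ⊕ β) ℂ) : Matrix (α ⊕ β) (α ⊕ β) ℂ)) i i₀ := by
      rw [Matrix.mul_apply]
      calc (((g⁻¹ : UForm α β) : GL (α ⊕ β) ℂ) : Matrix (α ⊕ β) (α ⊕ β) ℂ) i i₀
          = ((((g⁻¹ : UForm α β) : GL (α ⊕ β) ℂ) : Matrix (α ⊕ β) (α ⊕ β) ℂ) *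
              (1 : Matrix (α ⊕ β) (α ⊕ β) ℂ)) i i₀ := by rw [Matrix.mul_one]
        _ = ∑ k, (((g⁻¹ : UForm α β) : GL (α ⊕ β) ℂ) : Matrix (α ⊕ β) (α ⊕ β) ℂ) i k *
              (((g : UForm α β) : GL (α ⊕ β) ℂ) : Matrix (α ⊕ β) (α ⊕ β) ℂ) k i₀ := by
          rw [Matrix.mul_apply]
          exact Finset.sum_congr rfl fun k _ => by rw [hg i₀ hi₀ k]
    rw [e, ← UForm.coe_mul, inv_mul_cancel, UForm.coe_one]

/-- membership in the fixer. [cite: Knapp2002, Thm 7.39] -/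
theorem mem_fixer_iff {s : Set (α ⊕ β)} {g : UForm α β} :
    g ∈ fixer α β s ↔ ∀ i₀ ∈ s, ∀ i, (((g : UForm α β) : GL (α ⊕ β) ℂ) : Matrix (α ⊕ β) (α ⊕ β) ℂ) i i₀ =
      (1 : Matrix (α ⊕ β) (α ⊕ β) ℂ) i i₀ := Iff.rfl

/-- fixers are antitone in the set. [cite: Knapp2002, Thm 7.39] -/
theorem fixer_mono {s s' : Set (α ⊕ β)} (h : s ⊆ s') : fixer α β s' ≤ fixer α β s :=
  fun _ hg i₀ hi₀ => hg i₀ (h hi₀)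

/-- **a unit column forces a unit row**: if the `i₀`-th column of the matrix of `g ∈ U(α,β)` is `e_{i₀}`, so is its
`i₀`-th row (from `gᴴ J g = J` at the entries `(i₀, j)`: the form does not vanish on `e_{i₀}`). [cite: Knapp2002, I §1 Example 3] -/
theorem UForm.row_eq_of_col_eq (g : UForm α β) (i₀ : α ⊕ β)
    (h : ∀ i, (((g : UForm α β) : GL (α ⊕ β) ℂ) : Matrix (α ⊕ β) (α ⊕ β) ℂ) i i₀ =
      (1 : Matrix (α ⊕ β) (α ⊕ β) ℂ) i i₀) (j : α ⊕ β) :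
    (((g : UForm α β) : GL (α ⊕ β) ℂ) : Matrix (α ⊕ β) (α ⊕ β) ℂ) i₀ j = (1 : Matrix (α ⊕ β) (α ⊕ β) ℂ) i₀ j := by
  set M := (((g : UForm α β) : GL (α ⊕ β) ℂ) : Matrix (α ⊕ β) (α ⊕ β) ℂ) with hM
  have h1 : Mᴴ * signForm α β * M = signForm α β := (mem_unitaryGroupOfForm_star_iff_conjTranspose _ _).1 g.2
  have e := congrFun (congrFun h1 i₀) j
  rw [Matrix.mul_assoc, Matrix.mul_apply, Finset.sum_eq_single i₀ (fun l _ hl => by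
      rw [Matrix.conjTranspose_apply, h l, Matrix.one_apply_ne hl, star_zero, zero_mul])
      (fun h' => absurd (Finset.mem_univ i₀) h'), Matrix.conjTranspose_apply, h i₀, Matrix.one_apply_eq, star_one,
      one_mul, signForm_eq_diagonal, Matrix.diagonal_mul, Matrix.diagonal_apply] at e
  have hd : (Sum.elim (fun _ : α => (1 : ℂ)) (fun _ : β => -1)) i₀ ≠ 0 := by
    rcases i₀ with a | b
    · simp
    · simp
  rw [Matrix.one_apply]
  by_cases hij : i₀ = j
  · rw [if_pos hij] at e ⊢
    exact (mul_eq_left₀ hd).1 e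
  · rw [if_neg hij] at e ⊢
    exact (mul_eq_zero.1 e).resolve_left hd

/-- rows of a fixer element: for `g ∈ fixer s` and `i₀ ∈ s` the `i₀`-th row of the matrix of `g` is `e_{i₀}`. [cite: Knapp2002, Thm 7.39] -/
theorem row_eq_of_mem_fixer {s : Set (α ⊕ β)} {g : UForm α β} (hg : g ∈ fixer α β s) {i₀ : α ⊕ β} (hi₀ : i₀ ∈ s)
    (j : α ⊕ β) :
    (((g : UForm α β) : GL (α ⊕ β) ℂ) : Matrix (α ⊕ β) (α ⊕ β) ℂ) i₀ j = (1 : Matrix (α ⊕ β) (α ⊕ β) ℂ) i₀ j :=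
  UForm.row_eq_of_col_eq g i₀ (hg i₀ hi₀) j

/-- **`kV (u, w)` fixes `e_{inl a}` when the `a`-th column of `u` is `e_a`, and `e_{inr b}` when the `b`-th column of
`w` is `e_b`.** [cite: Knapp2002, Thm 7.39] -/
theorem kV_mem_fixer {s : Set (α ⊕ β)} (u : Matrix.unitaryGroup α ℂ) (w : Matrix.unitaryGroup β ℂ)
    (hu : ∀ a, Sum.inl a ∈ s → ∀ a', (u : Matrix α α ℂ) a' a = (1 : Matrix α α ℂ) a' a)
    (hw : ∀ b, Sum.inr b ∈ s → ∀ b', (w : Matrix β β ℂ) b' b = (1 : Matrix β β ℂ) b' b) :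
    UForm.kV α β (u, w) ∈ fixer α β s := by
  intro i₀ hi₀ i
  rw [UForm.coe_kV]
  rcases i₀ with a | b <;> rcases i with a' | b'
  · rw [Matrix.fromBlocks_apply₁₁, hu a hi₀ a']
    by_cases h : a' = a
    · rw [h, Matrix.one_apply_eq, Matrix.one_apply_eq]
    · rw [Matrix.one_apply_ne h, Matrix.one_apply_ne fun h' => h (Sum.inl_injective h')]
  · rw [Matrix.fromBlocks_apply₂₁, Matrix.zero_apply, Matrix.one_apply_ne Sum.inr_ne_inl]
  · rw [Matrix.fromBlocks_apply₁₂, Matrix.zero_apply, Matrix.one_apply_ne Sum.inl_ne_inr]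
  · rw [Matrix.fromBlocks_apply₂₂, hw b hi₀ b']
    by_cases h : b' = b
    · rw [h, Matrix.one_apply_eq, Matrix.one_apply_eq]
    · rw [Matrix.one_apply_ne h, Matrix.one_apply_ne fun h' => h (Sum.inr_injective h')]

/-- `kV (1, w)` fixes every `e_{inl a}` and the `e_{inr b}` fixed by `w`. [cite: Knapp2002, Thm 7.39] -/
theorem kV_one_mem_fixer {s : Set (α ⊕ β)} (w : Matrix.unitaryGroup β ℂ)
    (hw : ∀ b, Sum.inr b ∈ s → ∀ b', (w : Matrix β β ℂ) b' b = (1 : Matrix β β ℂ) b' b) :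
    UForm.kV α β (1, w) ∈ fixer α β s :=
  kV_mem_fixer 1 w (fun a _ a' => by rw [OneMemClass.coe_one]) hw

/-- `kV (u, 1)` fixes every `e_{inr b}` and the `e_{inl a}` fixed by `u`. [cite: Knapp2002, Thm 7.39] -/
theorem kV_mem_fixer_one {s : Set (α ⊕ β)} (u : Matrix.unitaryGroup α ℂ)
    (hu : ∀ a, Sum.inl a ∈ s → ∀ a', (u : Matrix α α ℂ) a' a = (1 : Matrix α α ℂ) a' a) :
    UForm.kV α β (u, 1) ∈ fixer α β s :=
  kV_mem_fixer u 1 hu (fun b _ b' => by rw [OneMemClass.coe_one])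

variable (p₀ : α) (q₀ : β)

/-- **the planar boost `a_t` of the plane `(p₀, q₀)` has unit columns off the plane.** [cite: Knapp2002, Thm 7.39] -/
theorem hypV_col_eq_one (t : ℝ) (i₀ : α ⊕ β) (h₁ : i₀ ≠ Sum.inl p₀) (h₂ : i₀ ≠ Sum.inr q₀) (i : α ⊕ β) :
    (((hypV p₀ q₀ t : UForm α β) : GL (α ⊕ β) ℂ) : Matrix (α ⊕ β) (α ⊕ β) ℂ) i i₀ =
      (1 : Matrix (α ⊕ β) (α ⊕ β) ℂ) i i₀ := by
  rcases i₀ with a₀ | b₀ <;> rcases i with a | b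
  · have ha₀ : a₀ ≠ p₀ := fun h => h₁ (by rw [h])
    rw [hypV_inl_inl]
    by_cases ha : a = p₀
    · rw [if_pos ha, if_neg ha₀, Matrix.one_apply_ne fun h' => ha₀ ((Sum.inl_injective h').symm.trans ha)]
    · rw [if_neg ha]
      by_cases h : a₀ = a
      · rw [if_pos h, h, Matrix.one_apply_eq]
      · rw [if_neg h, Matrix.one_apply_ne fun h' => h (Sum.inl_injective h').symm]
  · have ha₀ : a₀ ≠ p₀ := fun h => h₁ (by rw [h])
    rw [hypV_inr_inl, if_neg (fun h => ha₀ h.2), Matrix.one_apply_ne Sum.inr_ne_inl]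
  · have hb₀ : b₀ ≠ q₀ := fun h => h₂ (by rw [h])
    rw [hypV_inl_inr, if_neg (fun h => hb₀ h.2), Matrix.one_apply_ne Sum.inl_ne_inr]
  · have hb₀ : b₀ ≠ q₀ := fun h => h₂ (by rw [h])
    rw [hypV_inr_inr]
    by_cases hb : b = q₀
    · rw [if_pos hb, if_neg hb₀, Matrix.one_apply_ne fun h' => hb₀ ((Sum.inr_injective h').symm.trans hb)]
    · rw [if_neg hb]
      by_cases h : b₀ = b
      · rw [if_pos h, h, Matrix.one_apply_eq]
      · rw [if_neg h, Matrix.one_apply_ne fun h' => h (Sum.inr_injective h').symm]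

/-- **the planar boost of the plane `(p₀, q₀)` fixes every basis vector off the plane**: `a_t ∈ fixer s` whenever
`inl p₀, inr q₀ ∉ s`. [cite: Knapp2002, Thm 7.39] -/
theorem hypV_mem_fixer {s : Set (α ⊕ β)} (hp : Sum.inl p₀ ∉ s) (hq : Sum.inr q₀ ∉ s) (t : ℝ) :
    (hypV p₀ q₀ t : UForm α β) ∈ fixer α β s :=
  fun i₀ hi₀ i => hypV_col_eq_one p₀ q₀ t i₀ (fun h => hp (h ▸ hi₀)) (fun h => hq (h ▸ hi₀)) i

end Fixer

/-! ## 3. One side fixed: the element is in `K` -/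

section OneSide

/-- **an element of `U(α,β)` fixing every `e_{inr b}` is `diag(u, 1)`**: its off-diagonal blocks vanish (unit columns
and unit rows) and its `α`-block is unitary by `gᴴ J g = J`. [cite: Knapp2002, Thm 7.39] -/
theorem exists_eq_kV_inl_of_forall_inr (g : UForm α β)
    (h : ∀ b i, (((g : UForm α β) : GL (α ⊕ β) ℂ) : Matrix (α ⊕ β) (α ⊕ β) ℂ) i (Sum.inr b) =
      (1 : Matrix (α ⊕ β) (α ⊕ β) ℂ) i (Sum.inr b)) :
    ∃ u : Matrix.unitaryGroup α ℂ, g = UForm.kV α β (u, 1) := by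
  set M := (((g : UForm α β) : GL (α ⊕ β) ℂ) : Matrix (α ⊕ β) (α ⊕ β) ℂ) with hM
  have hrow : ∀ b j, M (Sum.inr b) j = (1 : Matrix (α ⊕ β) (α ⊕ β) ℂ) (Sum.inr b) j :=
    fun b j => UForm.row_eq_of_col_eq g (Sum.inr b) (h b) j
  let A : Matrix α α ℂ := fun a a' => M (Sum.inl a) (Sum.inl a')
  have hA : A ∈ Matrix.unitaryGroup α ℂ := by
    rw [Matrix.mem_unitaryGroup_iff']
    ext a₁ a₂
    have e := UForm.form_apply g (Sum.inl a₁) (Sum.inl a₂)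
    simp only [← hM] at e
    have hz : ∑ b, star (M (Sum.inr b) (Sum.inl a₁)) * M (Sum.inr b) (Sum.inl a₂) = 0 :=
      Finset.sum_eq_zero fun b _ => by rw [hrow b, Matrix.one_apply_ne Sum.inr_ne_inl, star_zero, zero_mul]
    rw [hz, sub_zero] at e
    rw [Matrix.mul_apply]
    change ∑ a, star (M (Sum.inl a) (Sum.inl a₁)) * M (Sum.inl a) (Sum.inl a₂) = (1 : Matrix α α ℂ) a₁ a₂
    rw [e]
    rfl
  refine ⟨⟨A, hA⟩, Subtype.ext (Units.ext ?_)⟩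
  change M = (((UForm.kV α β (⟨A, hA⟩, 1) : UForm α β) : GL (α ⊕ β) ℂ) : Matrix (α ⊕ β) (α ⊕ β) ℂ)
  rw [UForm.coe_kV]
  ext i j
  rcases i with a | b <;> rcases j with a' | b'
  · rfl
  · rw [Matrix.fromBlocks_apply₁₂, Matrix.zero_apply, h, Matrix.one_apply_ne Sum.inl_ne_inr]
  · rw [Matrix.fromBlocks_apply₂₁, Matrix.zero_apply, hrow, Matrix.one_apply_ne Sum.inr_ne_inl]
  · rw [Matrix.fromBlocks_apply₂₂, OneMemClass.coe_one, h]
    by_cases hb : b = b'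
    · rw [hb, Matrix.one_apply_eq, Matrix.one_apply_eq]
    · rw [Matrix.one_apply_ne hb, Matrix.one_apply_ne fun h' => hb (Sum.inr_injective h')]

/-- **an element of `U(α,β)` fixing every `e_{inl a}` is `diag(1, w)`.** [cite: Knapp2002, Thm 7.39] -/
theorem exists_eq_kV_inr_of_forall_inl (g : UForm α β)
    (h : ∀ a i, (((g : UForm α β) : GL (α ⊕ β) ℂ) : Matrix (α ⊕ β) (α ⊕ β) ℂ) i (Sum.inl a) =
      (1 : Matrix (α ⊕ β) (α ⊕ β) ℂ) i (Sum.inl a)) :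
    ∃ w : Matrix.unitaryGroup β ℂ, g = UForm.kV α β (1, w) := by
  set M := (((g : UForm α β) : GL (α ⊕ β) ℂ) : Matrix (α ⊕ β) (α ⊕ β) ℂ) with hM
  have hrow : ∀ a j, M (Sum.inl a) j = (1 : Matrix (α ⊕ β) (α ⊕ β) ℂ) (Sum.inl a) j :=
    fun a j => UForm.row_eq_of_col_eq g (Sum.inl a) (h a) j
  let D : Matrix β β ℂ := fun b b' => M (Sum.inr b) (Sum.inr b')
  have hD : D ∈ Matrix.unitaryGroup β ℂ := by
    rw [Matrix.mem_unitaryGroup_iff']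
    ext b₁ b₂
    have e := UForm.form_apply g (Sum.inr b₁) (Sum.inr b₂)
    simp only [← hM] at e
    have hz : ∑ a, star (M (Sum.inl a) (Sum.inr b₁)) * M (Sum.inl a) (Sum.inr b₂) = 0 :=
      Finset.sum_eq_zero fun a _ => by rw [hrow a, Matrix.one_apply_ne Sum.inl_ne_inr, star_zero, zero_mul]
    rw [hz, zero_sub] at e
    rw [Matrix.mul_apply]
    change ∑ b, star (M (Sum.inr b) (Sum.inr b₁)) * M (Sum.inr b) (Sum.inr b₂) = (1 : Matrix β β ℂ) b₁ b₂
    rw [← neg_neg (∑ b, star (M (Sum.inr b) (Sum.inr b₁)) * M (Sum.inr b) (Sum.inr b₂)), e]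
    change -(-(1 : Matrix β β ℂ) b₁ b₂) = (1 : Matrix β β ℂ) b₁ b₂
    rw [neg_neg]
  refine ⟨⟨D, hD⟩, Subtype.ext (Units.ext ?_)⟩
  change M = (((UForm.kV α β (1, ⟨D, hD⟩) : UForm α β) : GL (α ⊕ β) ℂ) : Matrix (α ⊕ β) (α ⊕ β) ℂ)
  rw [UForm.coe_kV]
  ext i j
  rcases i with a | b <;> rcases j with a' | b'
  · rw [Matrix.fromBlocks_apply₁₁, OneMemClass.coe_one, h]
    by_cases ha : a = a'
    · rw [ha, Matrix.one_apply_eq, Matrix.one_apply_eq]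
    · rw [Matrix.one_apply_ne ha, Matrix.one_apply_ne fun h' => ha (Sum.inl_injective h')]
  · rw [Matrix.fromBlocks_apply₁₂, Matrix.zero_apply, hrow, Matrix.one_apply_ne Sum.inl_ne_inr]
  · rw [Matrix.fromBlocks_apply₂₁, Matrix.zero_apply, h, Matrix.one_apply_ne Sum.inr_ne_inl]
  · rfl

end OneSide

/-! ## 4. Commutation across disjoint supports -/

section Commute

/-- **two square matrices, one the identity on the coordinates in `S` (unit rows and columns there), the other the
identity off `S`, commute** — both are block-diagonal for the splitting `S ⊔ Sᶜ`, with the identity in complementary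
blocks. [cite: Knapp2002, Thm 7.39] -/
theorem Matrix.mul_eq_mul_of_fix {n : Type*} [Fintype n] [DecidableEq n] (S : Set n) (X Y : Matrix n n ℂ)
    (hX : ∀ i ∈ S, ∀ k, X i k = (1 : Matrix n n ℂ) i k ∧ X k i = (1 : Matrix n n ℂ) k i)
    (hY : ∀ i ∉ S, ∀ k, Y i k = (1 : Matrix n n ℂ) i k ∧ Y k i = (1 : Matrix n n ℂ) k i) :
    X * Y = Y * X := by
  classical
  ext i j
  rw [Matrix.mul_apply, Matrix.mul_apply]
  by_cases hi : i ∈ S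
  · have hL : ∑ k, X i k * Y k j = Y i j := by
      rw [Finset.sum_congr rfl fun k _ => by rw [(hX i hi k).1], ← Matrix.mul_apply, Matrix.one_mul]
    rw [hL]
    by_cases hj : j ∈ S
    · rw [Finset.sum_congr rfl fun k _ => by rw [(hX j hj k).2], ← Matrix.mul_apply, Matrix.mul_one]
    · have hij : i ≠ j := fun h : i = j => hj (h ▸ hi)
      rw [(hY j hj i).2, Matrix.one_apply_ne hij, eq_comm]
      refine Finset.sum_eq_zero fun k _ => ?_
      by_cases hk : k ∈ S
      · rw [(hX k hk j).1, Matrix.one_apply_ne (fun h : k = j => hj (h ▸ hk)), mul_zero]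
      · rw [(hY k hk i).2, Matrix.one_apply_ne (fun h : i = k => hk (h ▸ hi)), zero_mul]
  · have hR : ∑ k, Y i k * X k j = X i j := by
      rw [Finset.sum_congr rfl fun k _ => by rw [(hY i hi k).1], ← Matrix.mul_apply, Matrix.one_mul]
    rw [hR]
    by_cases hj : j ∈ S
    · have hij : i ≠ j := fun h : i = j => hi (h ▸ hj)
      rw [(hX j hj i).2, Matrix.one_apply_ne hij]
      refine Finset.sum_eq_zero fun k _ => ?_
      by_cases hk : k ∈ S
      · rw [(hX k hk i).2, Matrix.one_apply_ne (fun h : i = k => hi (h ▸ hk)), zero_mul]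
      · rw [(hY k hk j).1, Matrix.one_apply_ne (fun h : k = j => hk (h ▸ hj)), mul_zero]
    · rw [Finset.sum_congr rfl fun k _ => by rw [(hY j hj k).2], ← Matrix.mul_apply, Matrix.mul_one]

variable (p₀ : α) (q₀ : β)

/-- **an element fixing `e_{p₀}` and `e_{q₀}` commutes with the boost of the plane `(p₀, q₀)`.** [cite: Knapp2002, Thm 7.39] -/
theorem mul_hypV_comm_of_mem_fixer (g : UForm α β) (hg : g ∈ fixer α β {Sum.inl p₀, Sum.inr q₀}) (t : ℝ) :
    g * hypV p₀ q₀ t = hypV p₀ q₀ t * g := by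
  refine Subtype.ext (Units.ext ?_)
  change (((g : UForm α β) : GL (α ⊕ β) ℂ) : Matrix (α ⊕ β) (α ⊕ β) ℂ) *
      (((hypV p₀ q₀ t : UForm α β) : GL (α ⊕ β) ℂ) : Matrix (α ⊕ β) (α ⊕ β) ℂ) =
    (((hypV p₀ q₀ t : UForm α β) : GL (α ⊕ β) ℂ) : Matrix (α ⊕ β) (α ⊕ β) ℂ) *
      (((g : UForm α β) : GL (α ⊕ β) ℂ) : Matrix (α ⊕ β) (α ⊕ β) ℂ)
  refine Matrix.mul_eq_mul_of_fix {Sum.inl p₀, Sum.inr q₀} _ _ (fun i hi k => ⟨row_eq_of_mem_fixer hg hi k, hg i hi k⟩)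
    fun i hi k => ?_
  have h₁ : i ≠ Sum.inl p₀ := fun h => hi (h ▸ Set.mem_insert _ _)
  have h₂ : i ≠ Sum.inr q₀ := fun h => hi (h ▸ Set.mem_insert_of_mem _ (Set.mem_singleton _))
  exact ⟨UForm.row_eq_of_col_eq _ i (hypV_col_eq_one p₀ q₀ t i h₁ h₂) k, hypV_col_eq_one p₀ q₀ t i h₁ h₂ k⟩

/-- **boosts in disjoint planes commute.** [cite: Knapp2002, Thm 7.39] -/
theorem hypV_comm {p₁ : α} {q₁ : β} (hp : p₁ ≠ p₀) (hq : q₁ ≠ q₀) (s t : ℝ) :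
    (hypV p₁ q₁ s : UForm α β) * hypV p₀ q₀ t = hypV p₀ q₀ t * hypV p₁ q₁ s :=
  mul_hypV_comm_of_mem_fixer p₀ q₀ _ (hypV_mem_fixer p₁ q₁
    (fun h => by
      rcases h with h | h
      · exact hp (Sum.inl_injective h)
      · exact Sum.inl_ne_inr h)
    (fun h => by
      rcases h with h | h
      · exact Sum.inr_ne_inl h
      · exact hq (Sum.inr_injective h)) s) t

/-- an element of `K` fixing `e_{p₀}` and `e_{q₀}` commutes with the boost of the plane `(p₀, q₀)`. [cite: Knapp2002, Thm 7.39] -/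
theorem kV_mul_hypV_comm (u : Matrix.unitaryGroup α ℂ) (w : Matrix.unitaryGroup β ℂ)
    (hu : ∀ a', (u : Matrix α α ℂ) a' p₀ = (1 : Matrix α α ℂ) a' p₀)
    (hw : ∀ b', (w : Matrix β β ℂ) b' q₀ = (1 : Matrix β β ℂ) b' q₀) (t : ℝ) :
    UForm.kV α β (u, w) * hypV p₀ q₀ t = hypV p₀ q₀ t * UForm.kV α β (u, w) :=
  mul_hypV_comm_of_mem_fixer p₀ q₀ _ (kV_mem_fixer u w
    (fun a ha a' => by
      rcases ha with h | h
      · rw [Sum.inl_injective h]; exact hu a'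
      · exact absurd h Sum.inl_ne_inr)
    (fun b hb b' => by
      rcases hb with h | h
      · exact absurd h Sum.inr_ne_inl
      · rw [show b = q₀ from Sum.inr_injective h]; exact hw b')) t

end Commute

/-! ## 5. Unitary matrices with prescribed orthonormal columns -/

section Columns

/-- **a unit vector vanishing on the coordinates in `F` is the `i₁`-th column (`i₁ ∉ F`) of a unitary matrix whose
`F`-columns are the unit vectors `e_i`, `i ∈ F`** (extend the orthonormal set `{e_i : i ∈ F} ∪ {y}` to an orthonormal
basis of `ℂⁿ`). [cite: HornJohnson2013, 0.6.5] -/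
theorem exists_unitaryGroup_col_eq_of_orthogonal {n : Type*} [Fintype n] [DecidableEq n] (F : Finset n) (i₁ : n)
    (hi₁ : i₁ ∉ F) (y : n → ℂ) (hy1 : ∑ k, ‖y k‖ ^ 2 = 1) (hy0 : ∀ k ∈ F, y k = 0) :
    ∃ u : Matrix.unitaryGroup n ℂ, (∀ k, (u : Matrix n n ℂ) k i₁ = y k) ∧
      ∀ i ∈ F, ∀ k, (u : Matrix n n ℂ) k i = (1 : Matrix n n ℂ) k i := by
  let x : EuclideanSpace ℂ n := WithLp.toLp 2 y
  have hx : ‖x‖ = 1 := by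
    rw [EuclideanSpace.norm_eq, Real.sqrt_eq_one]
    exact hy1
  let v : n → EuclideanSpace ℂ n := fun i => if i = i₁ then x else EuclideanSpace.single i 1
  let s : Set n := insert i₁ (↑F : Set n)
  have hmem : ∀ {i}, i ∈ s → i ≠ i₁ → i ∈ F := fun {i} hi hne => by
    rcases Set.mem_insert_iff.1 hi with h | h
    · exact absurd h hne
    · exact Finset.mem_coe.1 h
  have h : Orthonormal ℂ (s.restrict v) := by
    rw [orthonormal_iff_ite]
    rintro ⟨i, hi⟩ ⟨j, hj⟩
    simp only [Set.restrict_apply, Subtype.mk.injEq, v]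
    by_cases hi₁' : i = i₁ <;> by_cases hj₁' : j = i₁
    · subst hi₁'; subst hj₁'
      rw [if_pos rfl, if_pos rfl, inner_self_eq_norm_sq_to_K, hx]; norm_num
    · subst hi₁'
      rw [if_pos rfl, if_neg hj₁', EuclideanSpace.inner_single_right, if_neg (Ne.symm hj₁')]
      have : x j = y j := rfl
      rw [this, hy0 j (hmem hj hj₁'), map_zero, mul_zero]
    · subst hj₁'
      rw [if_neg hi₁', if_pos rfl, EuclideanSpace.inner_single_left, if_neg hi₁']
      have : x i = y i := rfl
      rw [this, hy0 i (hmem hi hi₁'), mul_zero]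
    · rw [if_neg hi₁', if_neg hj₁', EuclideanSpace.inner_single_left, map_one, one_mul]
      simp only [EuclideanSpace.single, PiLp.single_apply]
  obtain ⟨b, hb⟩ := h.exists_orthonormalBasis_extension_of_card_eq (E := EuclideanSpace ℂ n)
    finrank_euclideanSpace
  refine ⟨⟨(EuclideanSpace.basisFun n ℂ).toBasis.toMatrix b,
    (EuclideanSpace.basisFun n ℂ).toMatrix_orthonormalBasis_mem_unitary b⟩, fun k => ?_, fun i hi k => ?_⟩
  · change ((EuclideanSpace.basisFun n ℂ).toBasis.toMatrix b) k i₁ = y k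
    rw [Module.Basis.toMatrix_apply, OrthonormalBasis.coe_toBasis_repr_apply, EuclideanSpace.basisFun_repr,
      hb i₁ (Set.mem_insert _ _)]
    simp only [v, if_pos rfl]
    rfl
  · have hne : i ≠ i₁ := fun h => hi₁ (h ▸ hi)
    change ((EuclideanSpace.basisFun n ℂ).toBasis.toMatrix b) k i = (1 : Matrix n n ℂ) k i
    rw [Module.Basis.toMatrix_apply, OrthonormalBasis.coe_toBasis_repr_apply, EuclideanSpace.basisFun_repr,
      hb i (Set.mem_insert_of_mem _ (Finset.mem_coe.2 hi))]
    simp only [v, if_neg hne, EuclideanSpace.single, PiLp.single_apply, Matrix.one_apply]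

/-- columns of a unitary matrix that are unit vectors `e_i` give unit rows `e_i`. [cite: HornJohnson2013, Thm 2.1.4] -/
theorem unitaryGroup_row_eq_of_col_eq {n : Type*} [Fintype n] [DecidableEq n] (u : Matrix.unitaryGroup n ℂ) (i : n)
    (h : ∀ k, (u : Matrix n n ℂ) k i = (1 : Matrix n n ℂ) k i) (k : n) :
    (u : Matrix n n ℂ) i k = (1 : Matrix n n ℂ) i k := by
  -- `uᴴ u = 1` at `(i, k)`: `Σ_l conj(u_{l i}) u_{l k} = δ_{i k}`, and the `i`-th column is `e_i`
  have e := congrFun (congrFun (Matrix.UnitaryGroup.star_mul_self u) i) k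
  rw [Matrix.mul_apply, Finset.sum_eq_single i (fun l _ hl => by
      rw [Matrix.star_apply, h l, Matrix.one_apply_ne hl, star_zero, zero_mul])
    (fun h' => absurd (Finset.mem_univ i) h'), Matrix.star_apply, h i, Matrix.one_apply_eq, star_one, one_mul] at e
  exact e

/-- the inverse (`= star`) of a unitary matrix with unit `i`-th column has unit `i`-th column. [cite: HornJohnson2013, Thm 2.1.4] -/
theorem unitaryGroup_inv_col_eq {n : Type*} [Fintype n] [DecidableEq n] (u : Matrix.unitaryGroup n ℂ) (i : n)
    (h : ∀ k, (u : Matrix n n ℂ) k i = (1 : Matrix n n ℂ) k i) (k : n) :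
    ((u⁻¹ : Matrix.unitaryGroup n ℂ) : Matrix n n ℂ) k i = (1 : Matrix n n ℂ) k i := by
  change (star (u : Matrix n n ℂ)) k i = (1 : Matrix n n ℂ) k i
  rw [Matrix.star_apply, unitaryGroup_row_eq_of_col_eq u i h k]
  by_cases hk : k = i
  · rw [hk, Matrix.one_apply_eq, star_one]
  · rw [Matrix.one_apply_ne hk, Matrix.one_apply_ne (Ne.symm hk), star_zero]

end Columns

end RealDualPair

end Literature.RepresentationTheory.KonnoKonno2007

end
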